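import Summits.ValiantsHypothesis.ValiantsHypothesis.Theorems.BarrierLeverChowHitsPartitionMinorsRFacePrivateLeading

/-!
# Route BarrierLever — item `ChowHitsPartitionMinorsR` (stmt-ValiantsHypothesis-21882):
# unit factors do not change which lower-set layouts a design hits

Helper file (`--supports stmt-ValiantsHypothesis-21882`; cell valiant-natproofs, rung V4, 𝒟-side
support item of route BarrierLever; prover seat val-np-p5 gen 29). Definition-free. Closes NO item.

The «unit reduction» of the seat memo (MEMO-21882-valnp5-g29.md §9–§10): if the row family `v` is
injective with face-closed (lower-set) range and `g` is a polynomial in the `x`-variables only, the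
partition matrix of `g · P` on `(v, w)` is `L · M(P)` with `L[i,k] = [v k ⊆ v i]·coeff_{x^{v i ∖ v k}} g`
(`partitionMatrix_pureX_mul`); `L` is triangular along `⊆`, nonsingular when `g(0) ≠ 0`. Dually for
pure-`y` factors and face-closed columns (`partitionMatrix_mul_pureY`). Hence multiplying a design by
pure-`x` / pure-`y` factors with nonzero constant term never changes WHICH lower-set layouts it hits
(`det_partitionMatrix_pureX_mul_ne_zero_iff`, `det_partitionMatrix_mul_pureY_ne_zero_iff`) — the
first brick of the kernel arrow «subset-sum interpolation SSI(R,C) ⇒ (R,C) is hit» (memo §10).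

WHAT THIS IS NOT: item 21882 is NOT proved; nothing on crux stmt-ValiantsHypothesis-14610 or on
`VP` versus `VNP`.
-/

set_option linter.dupNamespace false

namespace Summit.ValiantsHypothesis.ValiantsHypothesis.Theorems.BarrierLever.ChowFacePrivate

open Finset MvPolynomial
open Summit.ValiantsHypothesis.ValiantsHypothesis.Theorems.BarrierLever.BiadditiveDoor
  (coeff_partitionExpo_mul)

noncomputable section

variable {h r : ℕ} {K : Type*} [Field K]

/-! ## 1. Pure-`x` factors act on the rows -/

/-- Convolution with a pure-`x` polynomial: only the `y`-empty sub-exponents contribute. -/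
theorem coeff_partitionExpo_pureX_mul (g P : MvPolynomial (Fin (h + h)) K)
    (hg : ∀ S T : Finset (Fin h), T ≠ ∅ → coeff (∑ a ∈ S, Finsupp.single (Fin.castAdd h a) 1 +
          ∑ c ∈ T, Finsupp.single (Fin.natAdd h c) 1) g = 0) (U W : Finset (Fin h)) :
    coeff (∑ a ∈ U, Finsupp.single (Fin.castAdd h a) 1 +
          ∑ c ∈ W, Finsupp.single (Fin.natAdd h c) 1) (g * P) =
      ∑ S ∈ U.powerset, coeff (∑ a ∈ S, Finsupp.single (Fin.castAdd h a) 1 +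
          ∑ c ∈ (∅ : Finset (Fin h)), Finsupp.single (Fin.natAdd h c) 1) g * coeff (∑ a ∈ U \ S, Finsupp.single (Fin.castAdd h a) 1 +
          ∑ c ∈ W, Finsupp.single (Fin.natAdd h c) 1) P := by
  classical
  rw [coeff_partitionExpo_mul]
  refine Finset.sum_congr rfl fun S _ => ?_
  rw [Finset.sum_eq_single_of_mem ∅ (Finset.empty_mem_powerset W) (fun T _ hT => ?_),
    Finset.sdiff_empty]
  rw [hg S T hT, zero_mul]

/-- **Pure-`x` factors act on the rows of the partition matrix by a `⊆`-triangular matrix** (rows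
injective with face-closed range). -/
theorem partitionMatrix_pureX_mul (v w : Fin r → Finset (Fin h)) (hv : Function.Injective v)
    (hlow : ∀ i S, S ⊆ v i → ∃ k, v k = S) (g P : MvPolynomial (Fin (h + h)) K)
    (hg : ∀ S T : Finset (Fin h), T ≠ ∅ → coeff (∑ a ∈ S, Finsupp.single (Fin.castAdd h a) 1 +
          ∑ c ∈ T, Finsupp.single (Fin.natAdd h c) 1) g = 0) :
    (Matrix.of fun i j : Fin r => coeff (∑ a ∈ v i, Finsupp.single (Fin.castAdd h a) 1 +
          ∑ c ∈ w j, Finsupp.single (Fin.natAdd h c) 1) (g * P)) =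
      (Matrix.of fun i k : Fin r => if v k ⊆ v i then coeff (∑ a ∈ v i \ v k, Finsupp.single (Fin.castAdd h a) 1 +
          ∑ c ∈ (∅ : Finset (Fin h)), Finsupp.single (Fin.natAdd h c) 1) g else 0) *
        Matrix.of fun k j : Fin r => coeff (∑ a ∈ v k, Finsupp.single (Fin.castAdd h a) 1 +
          ∑ c ∈ w j, Finsupp.single (Fin.natAdd h c) 1) P := by
  classical
  ext i j
  rw [Matrix.mul_apply, Matrix.of_apply, coeff_partitionExpo_pureX_mul g P hg]
  have hR : ∀ k, (Matrix.of fun i k : Fin r => if v k ⊆ v i then coeff (∑ a ∈ v i \ v k, Finsupp.single (Fin.castAdd h a) 1 +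
          ∑ c ∈ (∅ : Finset (Fin h)), Finsupp.single (Fin.natAdd h c) 1) g else 0) i k *
      (Matrix.of fun k j : Fin r => coeff (∑ a ∈ v k, Finsupp.single (Fin.castAdd h a) 1 +
          ∑ c ∈ w j, Finsupp.single (Fin.natAdd h c) 1) P) k j =
      if v k ⊆ v i then coeff (∑ a ∈ v i \ v k, Finsupp.single (Fin.castAdd h a) 1 +
          ∑ c ∈ (∅ : Finset (Fin h)), Finsupp.single (Fin.natAdd h c) 1) g * coeff (∑ a ∈ v k, Finsupp.single (Fin.castAdd h a) 1 +
          ∑ c ∈ w j, Finsupp.single (Fin.natAdd h c) 1) P else 0 := by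
    intro k
    rw [Matrix.of_apply, Matrix.of_apply, ite_mul, zero_mul]
  rw [Finset.sum_congr rfl (fun k _ => hR k),
    ← sum_powerset_eq_sum_rows v hv hlow i (fun S' => coeff (∑ a ∈ v i \ S', Finsupp.single (Fin.castAdd h a) 1 +
          ∑ c ∈ (∅ : Finset (Fin h)), Finsupp.single (Fin.natAdd h c) 1) g * coeff (∑ a ∈ S', Finsupp.single (Fin.castAdd h a) 1 +
          ∑ c ∈ w j, Finsupp.single (Fin.natAdd h c) 1) P)]
  exact Finset.sum_nbij' (fun S => v i \ S) (fun S => v i \ S)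
    (fun S _ => Finset.mem_powerset.mpr Finset.sdiff_subset)
    (fun S _ => Finset.mem_powerset.mpr Finset.sdiff_subset)
    (fun S hS => Finset.sdiff_sdiff_eq_self (Finset.mem_powerset.mp hS))
    (fun S hS => Finset.sdiff_sdiff_eq_self (Finset.mem_powerset.mp hS))
    (fun S hS => by simp only [Finset.sdiff_sdiff_eq_self (Finset.mem_powerset.mp hS)])

/-- **Pure-`x` factors with nonzero constant term do not change the vanishing of partition minors**
(rows injective with face-closed range). -/
theorem det_partitionMatrix_pureX_mul_ne_zero_iff (v w : Fin r → Finset (Fin h))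
    (hv : Function.Injective v) (hlow : ∀ i S, S ⊆ v i → ∃ k, v k = S)
    (g P : MvPolynomial (Fin (h + h)) K) (hg : ∀ S T : Finset (Fin h), T ≠ ∅ → coeff (∑ a ∈ S, Finsupp.single (Fin.castAdd h a) 1 +
          ∑ c ∈ T, Finsupp.single (Fin.natAdd h c) 1) g = 0)
    (hg0 : coeff 0 g ≠ 0) :
    (Matrix.of fun i j : Fin r => coeff (∑ a ∈ v i, Finsupp.single (Fin.castAdd h a) 1 +
          ∑ c ∈ w j, Finsupp.single (Fin.natAdd h c) 1) (g * P)).det ≠ 0 ↔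
      (Matrix.of fun i j : Fin r => coeff (∑ a ∈ v i, Finsupp.single (Fin.castAdd h a) 1 +
          ∑ c ∈ w j, Finsupp.single (Fin.natAdd h c) 1) P).det ≠ 0 := by
  classical
  rw [partitionMatrix_pureX_mul v w hv hlow g P hg, Matrix.det_mul, mul_ne_zero_iff]
  refine and_iff_right (det_ne_zero_of_lowerTriangular_subset v hv _ (fun i k hik => ?_) (fun i => ?_))
  · by_contra hc
    exact hik (by rw [Matrix.of_apply, if_neg hc])
  · rw [Matrix.of_apply, if_pos (Finset.Subset.refl _), Finset.sdiff_self, Finset.sum_empty,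
      Finset.sum_empty, zero_add]
    exact hg0

/-! ## 2. Pure-`y` factors act on the columns -/

/-- Convolution with a pure-`y` polynomial: only the `x`-full sub-exponents contribute. -/
theorem coeff_partitionExpo_mul_pureY (P g' : MvPolynomial (Fin (h + h)) K)
    (hg' : ∀ S T : Finset (Fin h), S ≠ ∅ → coeff (∑ a ∈ S, Finsupp.single (Fin.castAdd h a) 1 +
          ∑ c ∈ T, Finsupp.single (Fin.natAdd h c) 1) g' = 0) (U W : Finset (Fin h)) :
    coeff (∑ a ∈ U, Finsupp.single (Fin.castAdd h a) 1 +
          ∑ c ∈ W, Finsupp.single (Fin.natAdd h c) 1) (P * g') =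
      ∑ T ∈ W.powerset, coeff (∑ a ∈ U, Finsupp.single (Fin.castAdd h a) 1 +
          ∑ c ∈ T, Finsupp.single (Fin.natAdd h c) 1) P * coeff (∑ a ∈ (∅ : Finset (Fin h)), Finsupp.single (Fin.castAdd h a) 1 +
          ∑ c ∈ W \ T, Finsupp.single (Fin.natAdd h c) 1) g' := by
  classical
  rw [coeff_partitionExpo_mul,
    Finset.sum_eq_single_of_mem U (Finset.mem_powerset_self U) (fun S hS hne => ?_)]
  · refine Finset.sum_congr rfl fun T _ => ?_
    rw [Finset.sdiff_self]
  · refine Finset.sum_eq_zero fun T _ => ?_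
    rw [hg' (U \ S) (W \ T) (fun e => hne ?_), mul_zero]
    exact Finset.Subset.antisymm (Finset.mem_powerset.mp hS) (Finset.sdiff_eq_empty_iff_subset.mp e)

/-- **Pure-`y` factors act on the columns of the partition matrix by a `⊆`-triangular matrix**
(columns injective with face-closed range). -/
theorem partitionMatrix_mul_pureY (v w : Fin r → Finset (Fin h)) (hw : Function.Injective w)
    (hloww : ∀ j T, T ⊆ w j → ∃ k, w k = T) (P g' : MvPolynomial (Fin (h + h)) K)
    (hg' : ∀ S T : Finset (Fin h), S ≠ ∅ → coeff (∑ a ∈ S, Finsupp.single (Fin.castAdd h a) 1 +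
          ∑ c ∈ T, Finsupp.single (Fin.natAdd h c) 1) g' = 0) :
    (Matrix.of fun i j : Fin r => coeff (∑ a ∈ v i, Finsupp.single (Fin.castAdd h a) 1 +
          ∑ c ∈ w j, Finsupp.single (Fin.natAdd h c) 1) (P * g')) =
      (Matrix.of fun i k : Fin r => coeff (∑ a ∈ v i, Finsupp.single (Fin.castAdd h a) 1 +
          ∑ c ∈ w k, Finsupp.single (Fin.natAdd h c) 1) P) *
        Matrix.of fun k j : Fin r => if w k ⊆ w j then coeff (∑ a ∈ (∅ : Finset (Fin h)), Finsupp.single (Fin.castAdd h a) 1 +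
          ∑ c ∈ w j \ w k, Finsupp.single (Fin.natAdd h c) 1) g' else 0 := by
  classical
  ext i j
  rw [Matrix.mul_apply, Matrix.of_apply, coeff_partitionExpo_mul_pureY P g' hg']
  have hR : ∀ k, (Matrix.of fun i k : Fin r => coeff (∑ a ∈ v i, Finsupp.single (Fin.castAdd h a) 1 +
          ∑ c ∈ w k, Finsupp.single (Fin.natAdd h c) 1) P) i k *
      (Matrix.of fun k j : Fin r => if w k ⊆ w j then coeff (∑ a ∈ (∅ : Finset (Fin h)), Finsupp.single (Fin.castAdd h a) 1 +
          ∑ c ∈ w j \ w k, Finsupp.single (Fin.natAdd h c) 1) g' else 0) k j =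
      if w k ⊆ w j then coeff (∑ a ∈ v i, Finsupp.single (Fin.castAdd h a) 1 +
          ∑ c ∈ w k, Finsupp.single (Fin.natAdd h c) 1) P * coeff (∑ a ∈ (∅ : Finset (Fin h)), Finsupp.single (Fin.castAdd h a) 1 +
          ∑ c ∈ w j \ w k, Finsupp.single (Fin.natAdd h c) 1) g' else 0 := by
    intro k
    rw [Matrix.of_apply, Matrix.of_apply, mul_ite, mul_zero]
  rw [Finset.sum_congr rfl (fun k _ => hR k),
    ← sum_powerset_eq_sum_rows w hw hloww j (fun T => coeff (∑ a ∈ v i, Finsupp.single (Fin.castAdd h a) 1 +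
          ∑ c ∈ T, Finsupp.single (Fin.natAdd h c) 1) P * coeff (∑ a ∈ (∅ : Finset (Fin h)), Finsupp.single (Fin.castAdd h a) 1 +
          ∑ c ∈ w j \ T, Finsupp.single (Fin.natAdd h c) 1) g')]

/-- **Pure-`y` factors with nonzero constant term do not change the vanishing of partition minors**
(columns injective with face-closed range). -/
theorem det_partitionMatrix_mul_pureY_ne_zero_iff (v w : Fin r → Finset (Fin h))
    (hw : Function.Injective w) (hloww : ∀ j T, T ⊆ w j → ∃ k, w k = T)
    (P g' : MvPolynomial (Fin (h + h)) K) (hg' : ∀ S T : Finset (Fin h), S ≠ ∅ → coeff (∑ a ∈ S, Finsupp.single (Fin.castAdd h a) 1 +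
          ∑ c ∈ T, Finsupp.single (Fin.natAdd h c) 1) g' = 0)
    (hg0 : coeff 0 g' ≠ 0) :
    (Matrix.of fun i j : Fin r => coeff (∑ a ∈ v i, Finsupp.single (Fin.castAdd h a) 1 +
          ∑ c ∈ w j, Finsupp.single (Fin.natAdd h c) 1) (P * g')).det ≠ 0 ↔
      (Matrix.of fun i j : Fin r => coeff (∑ a ∈ v i, Finsupp.single (Fin.castAdd h a) 1 +
          ∑ c ∈ w j, Finsupp.single (Fin.natAdd h c) 1) P).det ≠ 0 := by
  classical
  rw [partitionMatrix_mul_pureY v w hw hloww P g' hg', Matrix.det_mul, mul_ne_zero_iff]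
  refine and_iff_left ?_
  rw [← Matrix.det_transpose]
  refine det_ne_zero_of_lowerTriangular_subset w hw _ (fun i k hik => ?_) (fun i => ?_)
  · by_contra hc
    exact hik (by rw [Matrix.transpose_apply, Matrix.of_apply, if_neg hc])
  · rw [Matrix.transpose_apply, Matrix.of_apply, if_pos (Finset.Subset.refl _), Finset.sdiff_self,
      Finset.sum_empty, Finset.sum_empty, zero_add]
    exact hg0

end

end Summit.ValiantsHypothesis.ValiantsHypothesis.Theorems.BarrierLever.ChowFacePrivate
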